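import Summits.BirchSwinnertonDyer.Rank1Residual.X11b.AnticyclotomicOpenInput
import Literature.NumberTheory.Automorphic.AdicCompletionDegreeOnePlaceEquiv
import Literature.NumberTheory.EllipticCurves.ComplexMultiplicationDeuringLocalPlaces
import Literature.NumberTheory.EllipticCurves.PadicPointsFiltration
import Literature.NumberTheory.EllipticCurves.BSDConductorProofs
import Mathlib.NumberTheory.Padics.HeightOneSpectrum
import HarnessLib

/-!
# X11b, route R1 — the embedding `K ↪ K_𝔭 = ℚ_p` at a degree-one prime and `ord_p log_{ω_E} P`
# on tree objects (the last local number of Castella's Thm. 2.3 / Thm. 3.2)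

HONEST FRAMING (cell `b2b-bsdres`, run/shared/lean/b2b/bsd-rank1-residual/, verbatim in every
file): the goal of the cell is to DELETE the COMBINATION-SHAPED residual classes of the
Birch–Swinnerton-Dyer formula for ALL analytic-rank `≤ 1` elliptic curves over `ℚ` — "full BSD
formula for every rank `≤ 1` curve in class `C`" assembled STRICTLY from published theorems — so
that the rank-`≤ 1` remainder becomes exactly the CONSTRUCTION-SHAPED classes, which are TYPED
(missing-input `Prop`s), NOT attempted. This is not "finishing BSD". Sub-cell
`b2b-bsdres-multr1-p1` (X11b, route R1); a RESEARCH ROUTE; no claim beyond the stated class; X11b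
stays CONSTRUCTION-SHAPED; nothing here changes a label; no named fact (definitions with bodies and
theorems; no `sorry`).

## Content

Castella, Camb. J. Math. 6 (2018) §2.2 (arXiv:1704.06608 p. 5): "Denote by `Ê` the formal group of
`E`, and let `log_{ω_E} : E(ℚ_p) → ℤ_p` the formal group logarithm attached to a fixed invariant
differential `ω_E` on `Ê` … Theorem 2.3. … `#ℤ_p/((1 − a_p p⁻¹ + ε_p) log_{ω_E} P)` … The formal group
logarithm defines an injective homomorphism `log_{ω_E} : E(K_𝔭)_{/tor} ⊗ ℤ_p → ℤ_p` mapping `E_1(K_𝔭)`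
isomorphically onto `pℤ_p`", where `P ∈ E(K) ⊂ E(K_𝔭)` and `K_𝔭 = ℚ_p` for the split prime
`p = 𝔭𝔭̄`. The gen-1 shadow carried this as the integer field `logOrd = ord_p log_{ω_E}(P)`. Here it
becomes a tree quantity:

* `ratPlace p` — the place of `ℚ` at `p`; `under_eq_ratPlace_of_mem` (a prime `𝔭 ∋ p` of `𝓞_K` lies
  over it).
* **`embAt K p 𝔭 h𝔭 he hf : K →+* ℚ_[p]`** — THE embedding of `K` into `ℚ_p = K_𝔭` at a prime
  `𝔭 ∣ p` of DEGREE ONE (`e(𝔭|p) = f(𝔭|p) = 1`, automatic when `p` splits in a quadratic `K`,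
  `degreeOne_of_splitsIn`): `K → K_𝔭` composed with the inverse of the tree's
  `adicCompletionEquivOfDegreeOne ℚ K (ratPlace p) 𝔭 : ℚ_v ≃+* K_𝔭` (Fröhlich–Taylor III (1.14)(a))
  and Mathlib's `Padic.adicCompletionEquiv : ℚ_[p] ≃A[ℚ] ℚ_v`. No choice involved: it is determined
  by `𝔭` (Castella's "`P ∈ E(K) ⊂ E(K_𝔭)`", the SAME `𝔭` at which `Sel_𝔭` is strict).
* `padicPointOf W p ι P ∈ E(ℚ_p)` — the image of `P ∈ E(K)` along an embedding `ι : K →+* ℚ_[p]`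
  (Mathlib `WeierstrassCurve.Affine.Point.map`); `formalIndex W p = [E(ℚ_p) : E₁(ℚ_p)]` (the index of
  the tree's `formalFiltration 1`; `= c_p · #Ẽ_ns(𝔽_p)`, `index_formalFiltration`);
  `formalIndex_smul_mem` (`m₀ • P ∈ E₁(ℚ_p)`).
* **`padicLogOrd W p ι P : ℤ := ord_p log_W(z(m₀ • P_ι)) − ord_p m₀`**, `m₀ = [E(ℚ_p):E₁(ℚ_p)]` —
  "`ord_p log_{ω_E} P`" ON TREE OBJECTS: the formal logarithm of the (minimal, `W` globally minimal)
  equation evaluated at the multiple of `P` lying in `E₁(ℚ_p)` where the tree's `padicLogPoint`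
  (AEC IV.6.4, VII.2.2) is the logarithm, renormalised by `ord_p m₀` (`log` extended `ℤ_p`-linearly
  to `E(ℚ_p) ⊗ ℤ_p`, as in Castella's "`E(K_𝔭)_{/tor} ⊗ ℤ_p → ℤ_p`"). A definition, no claim
  (`log(m P) = m log P` on `E₁`, AEC IV.6.4(a)/VII.2.2 = the tree's named fact `padicLogPoint_add`,
  is what makes it the printed number; not needed to STATE the links).
* `degreeOne_of_splitsIn` — for `[K:ℚ] = 2` and `p` split in `K` (`SplitsIn`, two primes above
  `p`), every prime `𝔭 ∋ p` of `𝓞_K` has `e = f = 1` (the tree's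
  `placesOver_trichotomy_of_finrank_eq_two` + `ncard_primesOver_span_eq`);
  `exists_degreeOnePrime_of_splitsIn` — such a `𝔭` exists.

The companion `AnticyclotomicLogLinks.lean` re-types (CTL) = Cas18 Thm. 2.3 and (IMC)∘(BDP) at the
trivial character with EVERY symbol a tree object.

References: [Castella2018] §2.2, Thm. 2.3 (arXiv:1704.06608 pp. 5–6); [SilvermanAEC2009] IV.6.4,
VII.2.2; [FrohlichTaylor1990] Ch. III §1 (1.14)(a).
-/

noncomputable section

open scoped Classical

open WeierstrassCurve NumberField IsDedekindDomain Literature.NumberTheory.EllipticCurves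
  Literature.NumberTheory.EllipticCurves.Rank1Residual Literature.NumberTheory.Automorphic

namespace Summit.BirchSwinnertonDyer.Rank1Residual.X11b

/-! ### The place of `ℚ` at `p` and the primes of `K` above it -/

section Place

variable (K : Type) [Field K] [NumberField K] (p : ℕ) [Fact p.Prime]

/-- The finite place of `ℚ` (prime of `𝓞 ℚ`) at the rational prime `p`
(`Rat.HeightOneSpectrum.primesEquiv`). [folklore] -/
def ratPlace : HeightOneSpectrum (𝓞 ℚ) :=
  (Rat.HeightOneSpectrum.primesEquiv (R := 𝓞 ℚ)).symm ⟨p, Fact.out⟩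

/-- `primesEquiv (ratPlace p) = p`. [folklore] -/
theorem primesEquiv_ratPlace : (Rat.HeightOneSpectrum.primesEquiv (ratPlace p) : ℕ) = p := by
  rw [ratPlace, Equiv.apply_symm_apply]

variable {K p}

/-- A prime `𝔭` of `𝓞_K` containing `p` lies over the place of `ℚ` at `p`. [folklore] -/
theorem under_eq_ratPlace_of_mem {𝔭 : HeightOneSpectrum (𝓞 K)} (h𝔭 : ((p : ℕ) : 𝓞 K) ∈ 𝔭.asIdeal) :
    𝔭.under (𝓞 ℚ) = ratPlace p := by
  have hmem : ((p : ℕ) : 𝓞 ℚ) ∈ (𝔭.under (𝓞 ℚ)).asIdeal := by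
    rw [HeightOneSpectrum.under_asIdeal, Ideal.under_def, Ideal.mem_comap, map_natCast]
    exact h𝔭
  exact (natCast_mem_asIdeal_iff_eq_primesEquiv_symm _ Fact.out).mp hmem

/-- Conversely a prime over the place at `p` contains `p`. [folklore] -/
theorem mem_of_under_eq_ratPlace {𝔭 : HeightOneSpectrum (𝓞 K)} (h : 𝔭.under (𝓞 ℚ) = ratPlace p) :
    ((p : ℕ) : 𝓞 K) ∈ 𝔭.asIdeal := by
  have hmem : ((p : ℕ) : 𝓞 ℚ) ∈ (𝔭.under (𝓞 ℚ)).asIdeal :=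
    (natCast_mem_asIdeal_iff_eq_primesEquiv_symm _ Fact.out).mpr h
  rw [HeightOneSpectrum.under_asIdeal, Ideal.under_def, Ideal.mem_comap, map_natCast] at hmem
  exact hmem

/-- **Split primes have degree one**: for `[K:ℚ] = 2` and `p` split in `K` (`SplitsIn K p`: two
primes of `𝓞_K` over `(p)`), every prime `𝔭 ∋ p` has `e(𝔭|p) = 1` and `f(𝔭|p) = 1` (the fundamental
identity `Σ e f = 2`; tree `placesOver_trichotomy_of_finrank_eq_two`). [folklore] -/
theorem degreeOne_of_splitsIn (h2 : Module.finrank ℚ K = 2) (hs : SplitsIn K p)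
    {𝔭 : HeightOneSpectrum (𝓞 K)} (h𝔭 : ((p : ℕ) : 𝓞 K) ∈ 𝔭.asIdeal) :
    𝔭.asIdeal.ramificationIdx (𝓞 ℚ) = 1 ∧ 𝔭.asIdeal.inertiaDeg (𝓞 ℚ) = 1 := by
  have hv := under_eq_ratPlace_of_mem h𝔭
  have hcard : {w : HeightOneSpectrum (𝓞 K) | w.under (𝓞 ℚ) = ratPlace p}.ncard = 2 := by
    rw [← ncard_primesOver_span_eq K (ratPlace p), primesEquiv_ratPlace]
    exact hs
  rcases placesOver_trichotomy_of_finrank_eq_two K h2 (ratPlace p) with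
    ⟨w₁, w₂, _, _, hef⟩ | ⟨w, hset, -, -⟩ | ⟨w, hset, -, -⟩
  · exact hef 𝔭 hv
  · rw [hset, Set.ncard_singleton] at hcard; exact absurd hcard (by norm_num)
  · rw [hset, Set.ncard_singleton] at hcard; exact absurd hcard (by norm_num)

variable (K p) in
/-- A prime of `𝓞_K` above `p` exists, and when `p` splits in the quadratic `K` it has degree one.
[folklore] -/
theorem exists_degreeOnePrime_of_splitsIn (h2 : Module.finrank ℚ K = 2) (hs : SplitsIn K p) :
    ∃ 𝔭 : HeightOneSpectrum (𝓞 K), ((p : ℕ) : 𝓞 K) ∈ 𝔭.asIdeal ∧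
      𝔭.asIdeal.ramificationIdx (𝓞 ℚ) = 1 ∧ 𝔭.asIdeal.inertiaDeg (𝓞 ℚ) = 1 := by
  obtain ⟨𝔭, h𝔭⟩ :=
    Literature.NumberTheory.NumberFields.RingOfIntegers.exists_heightOneSpectrum_natCast_mem K
      (Fact.out : p.Prime)
  exact ⟨𝔭, h𝔭, degreeOne_of_splitsIn h2 hs h𝔭⟩

end Place

/-! ### THE embedding `K ↪ K_𝔭 = ℚ_p` at a degree-one prime -/

section Embedding

variable (K : Type) [Field K] [NumberField K] (p : ℕ) [Fact p.Prime]

/-- **`K ↪ K_𝔭 = ℚ_p` at a degree-one prime `𝔭 ∣ p`**: the composite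
`K → K_𝔭 ≃ ℚ_v ≃ ℚ_p` of the completion map, the inverse of the tree's degree-one isomorphism
`adicCompletionEquivOfDegreeOne ℚ K v 𝔭 : ℚ_v ≃+* K_𝔭` (`v` the place of `ℚ` at `p`), and Mathlib's
`Padic.adicCompletionEquiv : ℚ_[p] ≃A[ℚ] ℚ_v`. Castella §2.2: "`P ∈ E(K)` … `E(K_𝔭)` …
`log_{ω_E} : E(ℚ_p) → ℤ_p`" (`K_𝔭 = ℚ_p` as `p = 𝔭𝔭̄` splits). Determined by `𝔭`; no choice.
[cite: Castella2018, §2.2 and Thm. 2.3 (arXiv:1704.06608 p. 5)] [cite: FrohlichTaylor1990, Ch. III §1 (1.14)(a)] -/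
def embAt (𝔭 : HeightOneSpectrum (𝓞 K)) (h𝔭 : ((p : ℕ) : 𝓞 K) ∈ 𝔭.asIdeal)
    (he : 𝔭.asIdeal.ramificationIdx (𝓞 ℚ) = 1) (hf : 𝔭.asIdeal.inertiaDeg (𝓞 ℚ) = 1) : K →+* ℚ_[p] :=
  haveI : 𝔭.asIdeal.LiesOver (ratPlace p).asIdeal := ⟨by rw [← under_eq_ratPlace_of_mem h𝔭]; rfl⟩
  ((Padic.adicCompletionEquiv (𝓞 ℚ) ⟨p, Fact.out⟩).symm.toAlgEquiv.toRingEquiv.toRingHom.comp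
      (adicCompletionEquivOfDegreeOne ℚ K (ratPlace p) 𝔭 he hf).symm.toRingHom).comp
    (algebraMap K (𝔭.adicCompletion K))

end Embedding

/-! ### `ord_p log_{ω_E} P` on tree objects -/

section Log

variable (W : WeierstrassCurve ℚ) (p : ℕ) [Fact p.Prime] {K : Type} [Field K] [NumberField K]

/-- **The image `P_ι ∈ E(ℚ_p)` of `P ∈ E(K)` along an embedding `ι : K →+* ℚ_p`** (intended:
`ι = embAt K p 𝔭 …`, so `P_ι = P ∈ E(K) ⊂ E(K_𝔭) = E(ℚ_p)`). Mathlib's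
`WeierstrassCurve.Affine.Point.map`. [cite: Castella2018, Thm. 2.3 (arXiv:1704.06608 p. 5), "`P ∈ E(K)`" read in `E(K_𝔭)`] -/
def padicPointOf (ι : K →+* ℚ_[p]) (P : (W.baseChange K).toAffine.Point) :
    (W.baseChange ℚ_[p]).toAffine.Point :=
  WeierstrassCurve.Affine.Point.map ι.toRatAlgHom P

/-- `E ⊗ ℚ_p` is an elliptic curve when `E` is (instance plumbing through `baseChange = map`).
[folklore] -/
instance isElliptic_baseChange_padic [W.IsElliptic] : (W.baseChange ℚ_[p]).IsElliptic := by
  rw [baseChange]; infer_instance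

/-- A globally minimal `W/ℚ` is `ℤ_p`-minimal, hence `ℤ_p`-integral, over `ℚ_p` (tree
`isMinimal_map_padic_of_isGloballyMinimal`; Mathlib: minimal ⇒ integral), so that the formal-group
layer (`formalFiltration`, `padicLogPoint`) applies to `W ⊗ ℚ_p`. [cite: SilvermanAEC2009, VIII.8 (global minimal equations)] -/
instance isIntegral_baseChange_padic [W.IsGloballyMinimal] : (W.baseChange ℚ_[p]).IsIntegral ℤ_[p] :=
  haveI : (W.baseChange ℚ_[p]).IsMinimal ℤ_[p] := isMinimal_map_padic_of_isGloballyMinimal W p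
  inferInstance

/-- **`m₀ = [E(ℚ_p) : E₁(ℚ_p)]`**, the index of the kernel of reduction (the tree's
`formalFiltration 1`) for the globally minimal `W` read over `ℚ_p`; `= c_p · #Ẽ_ns(𝔽_p)`
(`index_formalFiltration`). [cite: SilvermanAEC2009, VII.2 Prop. 2.1 and VII.6.1] -/
def formalIndex [W.IsElliptic] [W.IsGloballyMinimal] : ℕ :=
  ((W.baseChange ℚ_[p]).formalFiltration 1).index

/-- `m₀ • Q ∈ E₁(ℚ_p)` for every `Q ∈ E(ℚ_p)`. [folklore] -/
theorem formalIndex_smul_mem [W.IsElliptic] [W.IsGloballyMinimal] (Q : (W.baseChange ℚ_[p]).toAffine.Point) :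
    formalIndex W p • Q ∈ (W.baseChange ℚ_[p]).formalFiltration 1 :=
  AddSubgroup.nsmul_index_mem _ Q

/-- **`ord_p log_{ω_E}(P)` ON TREE OBJECTS** for `P ∈ E(K)` read in `E(ℚ_p)` along `ι`:
`ord_p log_W(z(m₀ • P_ι)) − ord_p m₀`, where `m₀ = [E(ℚ_p):E₁(ℚ_p)]`, `m₀ • P_ι ∈ E₁(ℚ_p)` is in the
domain where the tree's `padicLogPoint` (`log_W ∘ z`, AEC IV.6.4 / VII.2.2, for the equation `W`,
minimal at `p` when `W` is globally minimal, so `ω = dx/(2y + a₁x + a₃)` is a Néron differential)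
IS the formal-group logarithm, and the subtraction renormalises the `ℤ_p`-linear extension
`log P := log(m₀P)/m₀` ("`log_{ω_E} : E(K_𝔭)_{/tor} ⊗ ℤ_p → ℤ_p`", Cas18 §2.2). `Padic.valuation` has
junk value `0` at `0` (not met for `P` of infinite order). A definition; nothing asserted.
[cite: Castella2018, §2.2 and Thm. 2.3 (arXiv:1704.06608 pp. 5–6)] [cite: SilvermanAEC2009, IV.6.4 and VII.2.2] -/
def padicLogOrd [W.IsElliptic] [W.IsGloballyMinimal] (ι : K →+* ℚ_[p]) (P : (W.baseChange K).toAffine.Point) : ℤ :=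
  ((W.baseChange ℚ_[p]).padicLogPoint (formalIndex W p • padicPointOf W p ι P)).valuation -
    (padicValNat p (formalIndex W p) : ℤ)

end Log

end Summit.BirchSwinnertonDyer.Rank1Residual.X11b

end
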